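import Summits.BirchSwinnertonDyer.BirchSwinnertonDyer.Theorems.AdditiveBranchIMCGordTwoRankZeroOffCaseOneThreeFieldRowTameClosed
import Summits.BirchSwinnertonDyer.BirchSwinnertonDyer.Theorems.AdditiveBranchIMCGordTwoRankOneTameRoadField
import Summits.BirchSwinnertonDyer.Rank1Residual.Additive.GordCycLeadingTermTwist
import Literature.NumberTheory.EllipticCurves.Rank1Residual.Typed.JointLower
import Literature.NumberTheory.EllipticCurves.Wuthrich2014.SurjectiveDivisibilityCyclotomicPrimeHalf
import Literature.NumberTheory.EllipticCurves.Delbourgo1998.RankZeroLeadingTerm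
import Literature.NumberTheory.EllipticCurves.BSDRootNumberModularityOnlyProofs
import Literature.NumberTheory.EllipticCurves.AnalyticRankModularityProofs
import HarnessLib

/-!
# Line `wan_tame_bdp_road` (crux `GordTwoRankOne`, stmt-BirchSwinnertonDyer-19358) — THE TAME SUB-ROW IN ANALYTIC RANK ONE, CLOSED MODULO PRINT

Theorems-side, sorry-free and importable form of the rank-one sibling's composition `WanTameBdpRoad.GordTwoRankOne_of`
(`Cruxes/GordTwoRankOne/Lines/wan_tame_bdp_road.lean` v14, pen bsd-addord-plan g40 = mirror of LEAD g7's `three_field_road` v26),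
offered by the K1 LEAD (cruxlead-19357 g8) as a helper for the pen's registry (no skeleton is touched here): for every `E/ℚ`
(globally minimal `W`) of analytic rank `1`, every `p` of cell (G-ord, `e = 2`) on the tame sub-row (`ThreeFieldRoadSupply.TameRoadRow`:
`p ≥ 5`, `ρ̄_{E,p}` onto, `E` semistable outside `p`, a Wan prime), `ord_p #Ш(E)_an ≤ ord_p #Ш(E)` — GIVEN THIRTEEN printed theorems as
named hypotheses (`missingLowerBoundAt_rankOne_of_tameRoadRow`), resp. ELEVEN (`…_elevenFacts`: parity and entire continuation derived
in the tree from the modular parametrisation). Road: the rank-one supply (`WanTameBdpRoadSupply.exists_fieldOne_gordTwo_rankOne`: tame-road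
field `K`, rank-zero twist `Wd`); the rank-free ♭-inclusion of the (G-ord) LEAD file (`ThreeFieldRowClosed.flatInclusion_tameRoadRow`,
p725074) ⟹ branch socket ⟹ Step L ⟹ joint lower half (`TameBranchSocket.…`, `TameJointLower.…`); the twist's UPPER half from the tree
(`ClassX4Gord.missingUpperBoundAt_rankZero_of_katoHalf`: Kato/Wuthrich's cyclotomic half at a surjective prime + Delbourgo); the kernel
`missingLowerBoundAt_of_joint_of_upper`. BSD is proved for no curve by this file: CONDITIONAL on the printed facts it names.
-/

noncomputable section

set_option linter.dupNamespace false

namespace Summit.BirchSwinnertonDyer.BirchSwinnertonDyer.Theorems.TameRoadRowRankOneClosed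

open scoped Classical

open NumberField IsDedekindDomain
open WeierstrassCurve Literature.NumberTheory.EllipticCurves
  Literature.NumberTheory.EllipticCurves.ModularForms
  Literature.NumberTheory.EllipticCurves.Rank1Residual
  Literature.NumberTheory.EllipticCurves.Rank1Residual.Typed

open Summit.BirchSwinnertonDyer.Rank1Residual
open Summit.BirchSwinnertonDyer.Rank1Residual.Additive
open Summit.BirchSwinnertonDyer.BirchSwinnertonDyer.Theorems
open Field Literature.NumberTheory.EllipticCurves.ModularForms
open ThreeFieldRoadSupply

/-- **THE TAME SUB-ROW IN ANALYTIC RANK ONE, CLOSED MODULO PRINT** (= `WanTameBdpRoad.GordTwoRankOne_of`'s tame branch with the cite stub's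
conjuncts as hypotheses): for `W.analyticRank = 1`, `N10.CellGordTwo W p`, `TameRoadRow W p`: `MissingLowerBoundAt W p`, GIVEN thirteen
printed theorems — Kato/Wuthrich's cyclotomic half at a surjective prime, Delbourgo 1998 Prop. 4, GZK, entire continuation, a modular
parametrisation, Friedberg–Hoffstein's non-vanishing twist with prescribed local behaviour, the parity fact, Gross–Zagier I.(7.3),
Cai–Shu–Tian Thm 1.1, Hsieh 2014 Thm B, Liu–Zhang–Zhang 2018, Castella–Liu–Wan 2022 Thm. 8.2.1 and §6.1. Proof: supply
(`WanTameBdpRoadSupply.exists_fieldOne_gordTwo_rankOne`) ∘ `ThreeFieldRowClosed.flatInclusion_tameRoadRow` ∘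
`TameBranchSocket.branchSocketAt_of_flatInclusionUnit_rankFree` ∘ `TameJointLower.tameStepLAt_of_branchSocketAt` ∘
`TameJointLower.jointLowerBoundAt_of_tameRoadField_of_stepL` ∘ `ClassX4Gord.missingUpperBoundAt_rankZero_of_katoHalf` ∘
`missingLowerBoundAt_of_joint_of_upper`. [cite: JetchevSkinnerWan2017, §7.4.1 (arXiv:1512.06894 p. 30)]
[cite: CastellaLiuWan2022, Thm. 8.2.1 (1)] [cite: Kato2004Asterisque, Thm. 17.4] [cite: Delbourgo1998, Prop. 4] -/
theorem missingLowerBoundAt_rankOne_of_tameRoadRow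
    (hWu : Wuthrich2014.kato_halfEigenCharIdeal_dvd_cyclotomicPrime_of_surjective)
    (hDel : Delbourgo1998.prop4_rankZero_pow_dvd_constantCoeff)
    (hGZK : rank_eq_analyticRank_of_analyticRank_le_one) (hmod : hasEntireLFunction_rat)
    (hmodP : nonempty_modularParametrizationData)
    (hF5 : friedbergHoffstein_exists_twist_ne_zero_ramifiedAt_splitAt)
    (hpar : ∀ W : WeierstrassCurve ℚ, Literature.NumberTheory.EllipticCurves.even_analyticRank_iff_rootNumber_eq_one W)
    (hGZ73 : GrossZagier1986_thm_I_7_3) (hCST : CaiShuTian2014.thm11_trivialChar)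
    (hB : Hsieh2014.thmB_exists_isHsiehLFunction_coeff_norm_eq_one_unrPeriod_ramifiedSteinberg)
    (hLZZ : LiuZhangZhang2018.thm151_thm153_modularCurve_heegnerVector_additive_ramifiedSteinberg)
    (h821 : CastellaLiuWan2022.thm821_XGr₂_charIdeal_mul_le_awayFromCyc_pStarTwist)
    (h61 : CastellaLiuWan2022.sec61_exists_isCastellaLiuWanLFunction₂_pStarTwist)
    (W : WeierstrassCurve ℚ) [W.IsElliptic] [W.IsGloballyMinimal] (p : ℕ) [Fact p.Prime]
    (hr : W.analyticRank = 1) (hcell : N10.CellGordTwo W p) (hrow : TameRoadRow W p) :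
    MissingLowerBoundAt W p := by
  have hrow' := hrow
  obtain ⟨hp5, hsurj, -, q, hqF, hqp, hq2, hqm, hqns, hqv⟩ := hrow'
  -- the supply: the tame-road field `K` and the rank-zero twist `Wd`
  obtain ⟨K, iF, iN, Wd, iWd, iWdm, hK, hqd, hsplit, h2, hpK, -, htw, -, hrd, hcelld, hsurjd⟩ :=
    WanTameBdpRoadSupply.exists_fieldOne_gordTwo_rankOne W p hF5 hpar hmod hp5 hr hcell hsurj hqp hq2 hqm hqns hqv
  have hTRF : TameRoadField W p K := ⟨hK, ⟨q, hqF, ⟨hqp, hq2, hqm, hqns, hqv⟩, hqd, hsplit⟩, h2, hpK⟩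
  have hsum : W.analyticRank + Wd.analyticRank = 1 := by omega
  -- the tame road: ♭-inclusion ⟹ branch socket ⟹ Step L ⟹ joint lower half
  have hIncl := ThreeFieldRowClosed.flatInclusion_tameRoadRow hmodP hB h821 h61 W p K hcell hrow hTRF
  have hsock := TameBranchSocket.branchSocketAt_of_flatInclusionUnit_rankFree hB hLZZ hCST hGZK hmod W p K hp5 hcell.2.1 hsurj
    hTRF hIncl
  have hstepL := TameJointLower.tameStepLAt_of_branchSocketAt hCST hGZK hmod W p K Wd hp5 hcell.2.1 hTRF htw hsum hsock
  have hJ : JointLowerBoundAt W Wd p :=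
    TameJointLower.jointLowerBoundAt_of_tameRoadField_of_stepL hCST hGZK hmod hmodP hGZ73 W p K Wd hp5 hTRF htw hsum hstepL
  -- the twist's upper half from the tree (rank `0`, `ρ̄` onto, `p ≥ 5`)
  have hX4 : ClassX4Gord Wd p :=
    ⟨⟨hcelld.1, hcelld.2.1, hasIrreducibleModPGaloisRep_of_hasSurjectiveModNGaloisRep Wd p hsurjd⟩, hcelld.2.2.1⟩
  have hed : semistabilityIndex Wd p = 2 := hcelld.2.2.2
  have hram3 : p = 3 → Ram Wd p := fun h3 ↦ absurd h3 (by omega)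
  exact missingLowerBoundAt_of_joint_of_upper hJ
    (ClassX4Gord.missingUpperBoundAt_rankZero_of_katoHalf hWu hDel hGZK hmod hmodP hX4 hed hrd hsurjd hram3)

/-- **The same from ELEVEN printed theorems**: the parity fact and the entire continuation are tree theorems given a modular
parametrisation (`exists_isNewformOf_of_nonempty_modularParametrizationData`, `even_analyticRank_iff_rootNumber_eq_one_of_exists_isNewformOf`,
`WeierstrassCurve.hasEntireLFunction_rat_of_exists_isNewformOf`). [cite: BCDTJAMS2001, Thm. A] [cite: JetchevSkinnerWan2017, §7.4.1] -/
theorem missingLowerBoundAt_rankOne_of_tameRoadRow_elevenFacts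
    (hWu : Wuthrich2014.kato_halfEigenCharIdeal_dvd_cyclotomicPrime_of_surjective)
    (hDel : Delbourgo1998.prop4_rankZero_pow_dvd_constantCoeff)
    (hGZK : rank_eq_analyticRank_of_analyticRank_le_one) (hmodP : nonempty_modularParametrizationData)
    (hF5 : friedbergHoffstein_exists_twist_ne_zero_ramifiedAt_splitAt)
    (hGZ73 : GrossZagier1986_thm_I_7_3) (hCST : CaiShuTian2014.thm11_trivialChar)
    (hB : Hsieh2014.thmB_exists_isHsiehLFunction_coeff_norm_eq_one_unrPeriod_ramifiedSteinberg)
    (hLZZ : LiuZhangZhang2018.thm151_thm153_modularCurve_heegnerVector_additive_ramifiedSteinberg)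
    (h821 : CastellaLiuWan2022.thm821_XGr₂_charIdeal_mul_le_awayFromCyc_pStarTwist)
    (h61 : CastellaLiuWan2022.sec61_exists_isCastellaLiuWanLFunction₂_pStarTwist)
    (W : WeierstrassCurve ℚ) [W.IsElliptic] [W.IsGloballyMinimal] (p : ℕ) [Fact p.Prime]
    (hr : W.analyticRank = 1) (hcell : N10.CellGordTwo W p) (hrow : TameRoadRow W p) :
    MissingLowerBoundAt W p :=
  have hnf : exists_isNewformOf := exists_isNewformOf_of_nonempty_modularParametrizationData hmodP
  missingLowerBoundAt_rankOne_of_tameRoadRow hWu hDel hGZK (WeierstrassCurve.hasEntireLFunction_rat_of_exists_isNewformOf hnf) hmodP hF5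
    (fun W' ↦ even_analyticRank_iff_rootNumber_eq_one_of_exists_isNewformOf W' hnf) hGZ73 hCST hB hLZZ h821 h61 W p hr hcell hrow

end Summit.BirchSwinnertonDyer.BirchSwinnertonDyer.Theorems.TameRoadRowRankOneClosed

end
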